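import Literature.NumberTheory.Rogawski1990.UnitStableOrbitalIntegralHSideValueTypeTwo    -- ★ B-p10: §1 isotropic cyclic frame `exists_rescaled_cyclicFrame`, §3 `…_of_unitary`
import Literature.NumberTheory.Automorphic.SelfDualLatticeAffineReductionTransport       -- ★ p851749 B-p08 (A1): `sub_smul_one_mul_self_eq_affine`
import HarnessLib

/-!
# The isotropic cyclic frame for the EISENSTEIN-CENTRED companion: the 2-free FRAME half of the type-(2) H-side value `#S(Φ₂, γ) = P_j` at every inert place

Topic `NumberTheory/Rogawski1990`; namespace `Literature.NumberTheory.Automorphic.UnitaryGroup`.  THEOREMS ONLY (no definition, no instance, no notation, no named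
fact, no `sorry`).  Cell `pub/hodgecm-mathlib`, F0∕P3c LH4 list M6 row «B-p10″» (LH4-plan (g6) WORD #73 (P5d); B-p08 (g40) M6 memo §4; census F0P3a-p02 (g22)
f548c516ca8dc384).  HC_CM is proved only modulo the printed citations until rung 0 closes; this file is unconditional and elementary, and reads NO hypothesis on `|2|`.

THE POINT.  In ★ `UnitStableOrbitalIntegralHSideValueTypeTwo` the value `#S((Φ₂)_w, g) = Σ_{k ≤ N} q^k` for a unitary `g` of type (2) is proved in two halves:
(FRAME) the rescaled isotropic cyclic frame `P′ = (e₀ | a·g e₀)`, `a = ϖ^{−r}`, conjugates `g` to the companion matrix `C(t, d) = !![0, −d; 1, t]` (`t = tr g`, `d = det g`)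
and the hyperbolic form `Φ₂ = !![0, 1; 1, 0]` to `!![0, β; σβ, 0]`, `β = a² g₁₀`, `|β| = |ϖ^e|`, `e ≤ 1`, with `d σβ = −β`, `β σt + σβ t = 0`, and the count is transported along `P′`
(★ (L5-d1) FILE A `ncard_selfDualStable_congr`); (COUNT) ★ (β2′-ii) counts `#S(!![0, β; σβ, 0], C(t, d))` reading `|2| = 1` (centre `t∕2`, depth `N` from `|t² − 4d|`).
The FRAME half is free of `2`: this file states it as a stand-alone SOCKET (§2 over any discretely valued field, §3 at an inert place `w` in the vocabulary of ★ §3), so that at a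
dyadic place the value theorem is the socket composed with a count keyed on the EISENSTEIN CENTRE `a` — the affine relation `(C − a·1)² = f·(C − a·1) + e′·1`, `f, e′ ∈ 𝓂`
(§1: `f = t − 2a`, `e′ = −χ_C(a)`, ★ (A1); its transport under `GL₂`-conjugation) — instead of `t∕2` and `|t² − 4d|`.

* §1 (any field) `companion_sub_smul_one_mul_self_eq_affine`; `coe_companion_affine_of_centre` (the `hk`-shape
  `(↑γ − a•1)*(↑γ − a•1) = f•(↑γ − a•1) + e′•1` from the scalars `f = t − 2a`, `e′ = −(a² − ta + d)`); `units_inv_mul_mul_affine_of_affine` (conjugation transport).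
* §2 (any `[ValuativeRel F]` with a `σ`-fixed uniformiser) **`exists_antidiag_companion_frame_of_unitary_antidiagOne`** (the frame data: `β, e, P′` with `|β| = |ϖ^e|`,
  `|det g| = 1`, `d σβ = −β`, `β σt + σβ t = 0`, `P′⁻¹ g P′ = C(t,d)`, Gram `!![0, β; σβ, 0]`) and the AFFINE counting socket
  **`exists_antidiag_companion_affine_frame_ncard_eq_of_unitary_antidiagOne`**: given moreover `(g − a·1)² = f·(g − a·1) + e′·1`,
  `∃ β e γ′, … ∧ ↑γ′ = C(t,d) ∧ (↑γ′ − a·1)² = f·(↑γ′ − a·1) + e′·1 ∧ #S(Φ₂, g) = #S(!![0, β; σβ, 0], γ′)`.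
* §3 (at an inert place `w ∣ v` of the CM extension) **`exists_antidiag_companion_affine_frame_ncard_eq_of_unitary`** — ★ `ncard_selfDualStable_antidiagTwo_eq_sum_of_unitary`
  with the binders `(h2v) (ht) (hirr) (N) (hN)` replaced by the Eisenstein relation of `g − a·1` and the count left abstract (`g₁₀ ≠ 0` from `hirr` is ★
  `apply_one_zero_ne_zero_of_not_exists_isRoot`).
PRIOR ART.  ★ (β0′) `SelfDualLatticeCountCyclicFrameCM.exists_cyclicFrame_ncard_selfDualStable_eq[_of_uniformizer]` is the plain (centre-free) frame-with-count theorem in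
the `unitaryGroup`-membership ∕ `hunif` vocabulary; the sockets here add `|det g| = 1`, `d σβ = −β` (the `hd` input of the companion counts) and the transported affine
relation, in the binder shapes of ★ B-p10 §3 (`hgU` as a matrix identity, `g₁₀ ≠ 0`, `valuation`, DVR instance) so that the dyadic value theorem is a drop-in.

## References
* [Flicker1998UnitaryFL] Y. Z. Flicker, *Elementary proof of the fundamental lemma for a unitary group*, Canad. J. Math. 50 (1998), §6 p. 95 REMARK, p. 97.
* [Rogawski1990] J. D. Rogawski, *Automorphic Representations of Unitary Groups in Three Variables* (1990), §3.6 p. 31; §4.9 Lemma 4.9.3 p. 56.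
* [Serre1979] J.-P. Serre, *Local Fields*, GTM 67 (1979), Ch. I §6 (Eisenstein equations).
-/

set_option autoImplicit false

noncomputable section

open MeasureTheory NumberField IsDedekindDomain Matrix Finset ValuativeRel
open scoped ValuativeRel Matrix MatrixGroups

namespace Literature.NumberTheory.Automorphic.UnitaryGroup

open Literature.NumberTheory.Rogawski1990

/-! ## §1 The Eisenstein-centred companion (any field) -/

section Affine

variable {K : Type*} [Field K]

/-- **The affine (Eisenstein-centred) relation of the companion matrix**: for `C = !![0, −d; 1, t]` and any centre `a`,
`(C − a·1)² = (t − 2a)·(C − a·1) − χ_C(a)·1`, `χ_C(a) = a² − ta + d` (★ (A1) `sub_smul_one_mul_self_eq_affine` with `tr C = t`, `det C = d`).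
[cite: Serre1979, Ch. I §6] [cite: Rogawski1990, §3.6 p. 31] -/
theorem companion_sub_smul_one_mul_self_eq_affine (t d a : K) :
    ((!![0, -d; 1, t] : Matrix (Fin 2) (Fin 2) K) - a • (1 : Matrix (Fin 2) (Fin 2) K)) * ((!![0, -d; 1, t] : Matrix (Fin 2) (Fin 2) K) - a • (1 : Matrix (Fin 2) (Fin 2) K)) =
      (t - 2 * a) • ((!![0, -d; 1, t] : Matrix (Fin 2) (Fin 2) K) - a • (1 : Matrix (Fin 2) (Fin 2) K)) - (a * a - t * a + d) • (1 : Matrix (Fin 2) (Fin 2) K) := by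
  have h := sub_smul_one_mul_self_eq_affine (!![0, -d; 1, t] : Matrix (Fin 2) (Fin 2) K) a
  have htr : (!![0, -d; 1, t] : Matrix (Fin 2) (Fin 2) K).trace = t := by rw [Matrix.trace_fin_two_of, zero_add]
  have hdet : (!![0, -d; 1, t] : Matrix (Fin 2) (Fin 2) K).det = d := by rw [Matrix.det_fin_two_of]; ring
  rwa [htr, hdet] at h

/-- **The `hk`-shape of the affine relation for a companion element of `GL₂`**: if `↑γ = !![0, −d; 1, t]`, `f = t − 2a` and `e′ = −(a² − ta + d)`, then
`(↑γ − a·1)·(↑γ − a·1) = f·(↑γ − a·1) + e′·1` — the hypothesis shape of ★ (A4) `glIntReduction_sub_smul_one_sq_eq_zero_of_affine` and of the Eisenstein-centred counts.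
[cite: Serre1979, Ch. I §6] [cite: Rogawski1990, §3.6 p. 31] -/
theorem coe_companion_affine_of_centre (γ : GL (Fin 2) K) {t d a f e' : K} (hγ : (γ : Matrix (Fin 2) (Fin 2) K) = !![0, -d; 1, t])
    (hf : t - 2 * a = f) (he : -(a * a - t * a + d) = e') :
    ((γ : Matrix (Fin 2) (Fin 2) K) - a • (1 : Matrix (Fin 2) (Fin 2) K)) * ((γ : Matrix (Fin 2) (Fin 2) K) - a • (1 : Matrix (Fin 2) (Fin 2) K)) =
      f • ((γ : Matrix (Fin 2) (Fin 2) K) - a • (1 : Matrix (Fin 2) (Fin 2) K)) + e' • (1 : Matrix (Fin 2) (Fin 2) K) := by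
  rw [hγ, companion_sub_smul_one_mul_self_eq_affine, hf, ← he, neg_smul, sub_eq_add_neg]

/-- **Conjugation transports the affine relation**: if `(k − a·1)² = f·(k − a·1) + e′·1` then the same holds for `P⁻¹ k P` (`P ∈ GL₂`), since
`P⁻¹ k P − a·1 = P⁻¹ (k − a·1) P`. [cite: Rogawski1990, §4.9 Lemma 4.9.3 p. 56] -/
theorem units_inv_mul_mul_affine_of_affine (P : GL (Fin 2) K) (k : Matrix (Fin 2) (Fin 2) K) {a f e' : K}
    (hk : (k - a • (1 : Matrix (Fin 2) (Fin 2) K)) * (k - a • (1 : Matrix (Fin 2) (Fin 2) K)) = f • (k - a • (1 : Matrix (Fin 2) (Fin 2) K)) + e' • (1 : Matrix (Fin 2) (Fin 2) K)) :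
    (((P⁻¹ : GL (Fin 2) K) : Matrix (Fin 2) (Fin 2) K) * k * (P : Matrix (Fin 2) (Fin 2) K) - a • (1 : Matrix (Fin 2) (Fin 2) K)) *
        (((P⁻¹ : GL (Fin 2) K) : Matrix (Fin 2) (Fin 2) K) * k * (P : Matrix (Fin 2) (Fin 2) K) - a • (1 : Matrix (Fin 2) (Fin 2) K)) =
      f • (((P⁻¹ : GL (Fin 2) K) : Matrix (Fin 2) (Fin 2) K) * k * (P : Matrix (Fin 2) (Fin 2) K) - a • (1 : Matrix (Fin 2) (Fin 2) K)) + e' • (1 : Matrix (Fin 2) (Fin 2) K) := by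
  have hPP : ((P⁻¹ : GL (Fin 2) K) : Matrix (Fin 2) (Fin 2) K) * (P : Matrix (Fin 2) (Fin 2) K) = 1 := by
    rw [← Units.val_mul, inv_mul_cancel, Units.val_one]
  have hPP' : (P : Matrix (Fin 2) (Fin 2) K) * ((P⁻¹ : GL (Fin 2) K) : Matrix (Fin 2) (Fin 2) K) = 1 := by
    rw [← Units.val_mul, mul_inv_cancel, Units.val_one]
  have hconj : ((P⁻¹ : GL (Fin 2) K) : Matrix (Fin 2) (Fin 2) K) * k * (P : Matrix (Fin 2) (Fin 2) K) - a • (1 : Matrix (Fin 2) (Fin 2) K) =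
      ((P⁻¹ : GL (Fin 2) K) : Matrix (Fin 2) (Fin 2) K) * (k - a • (1 : Matrix (Fin 2) (Fin 2) K)) * (P : Matrix (Fin 2) (Fin 2) K) := by
    rw [Matrix.mul_sub, Matrix.sub_mul, Matrix.mul_smul, Matrix.mul_one, Matrix.smul_mul, hPP]
  rw [hconj]
  calc ((P⁻¹ : GL (Fin 2) K) : Matrix (Fin 2) (Fin 2) K) * (k - a • (1 : Matrix (Fin 2) (Fin 2) K)) * (P : Matrix (Fin 2) (Fin 2) K) *
          (((P⁻¹ : GL (Fin 2) K) : Matrix (Fin 2) (Fin 2) K) * (k - a • (1 : Matrix (Fin 2) (Fin 2) K)) * (P : Matrix (Fin 2) (Fin 2) K))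
        = ((P⁻¹ : GL (Fin 2) K) : Matrix (Fin 2) (Fin 2) K) * ((k - a • (1 : Matrix (Fin 2) (Fin 2) K)) *
            ((P : Matrix (Fin 2) (Fin 2) K) * ((P⁻¹ : GL (Fin 2) K) : Matrix (Fin 2) (Fin 2) K)) * (k - a • (1 : Matrix (Fin 2) (Fin 2) K))) * (P : Matrix (Fin 2) (Fin 2) K) := by
          simp only [Matrix.mul_assoc]
    _ = ((P⁻¹ : GL (Fin 2) K) : Matrix (Fin 2) (Fin 2) K) * (f • (k - a • (1 : Matrix (Fin 2) (Fin 2) K)) + e' • (1 : Matrix (Fin 2) (Fin 2) K)) * (P : Matrix (Fin 2) (Fin 2) K) := by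
          rw [hPP', Matrix.mul_one, hk]
    _ = f • (((P⁻¹ : GL (Fin 2) K) : Matrix (Fin 2) (Fin 2) K) * (k - a • (1 : Matrix (Fin 2) (Fin 2) K)) * (P : Matrix (Fin 2) (Fin 2) K)) + e' • (1 : Matrix (Fin 2) (Fin 2) K) := by
          rw [Matrix.mul_add, Matrix.add_mul, Matrix.mul_smul, Matrix.smul_mul, Matrix.mul_smul, Matrix.mul_one, Matrix.smul_mul, hPP]

end Affine

/-! ## §2 The frame socket over a discretely valued field -/

section Socket

variable {F : Type*} [Field F] [ValuativeRel F] {ϖ : F} (hϖ : IsUniformizingElement ϖ) (σ : F →+* F)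
  [IsDiscreteValuationRing 𝒪[F]] (hσϖ : σ ϖ = ϖ) (hσv : ∀ x, valuation F (σ x) = valuation F x)

include hϖ hσϖ hσv in
/-- **THE FRAME SOCKET** (2-free): for `g ∈ GL₂(F)` unitary for `Φ₂ = !![0, 1; 1, 0]` with `g₁₀ ≠ 0`, there are `β ∈ F`, `e ≤ 1` and a frame `P′ ∈ GL₂(F)` with
`|β| = |ϖ^e|`, `|det g| = 1`, `det g · σβ = −β`, `β σ(tr g) + σβ · tr g = 0`, `P′⁻¹ g P′ = !![0, −det g; 1, tr g]` and `ᵗ(σP′) Φ₂ P′ = !![0, β; σβ, 0]` — the isotropic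
cyclic frame `(e₀ | g e₀)` rescaled by `a = ϖ^{−r}`, `|g₁₀| = |ϖ^(2r+e)|`, `β = a² g₁₀` (★ `exists_rescaled_cyclicFrame`). [cite: Flicker1998UnitaryFL, §6 p. 97] [cite: Rogawski1990, §3.6 p. 31] -/
theorem exists_antidiag_companion_frame_of_unitary_antidiagOne (gGL : GL (Fin 2) F) (g : Matrix (Fin 2) (Fin 2) F) (hcoe : (gGL : Matrix (Fin 2) (Fin 2) F) = g)
    (hgU : (g.map σ)ᵀ * (!![0, 1; 1, 0] : Matrix (Fin 2) (Fin 2) F) * g = !![0, 1; 1, 0]) (hg10 : g 1 0 ≠ 0) :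
    ∃ (β : F) (e : ℕ) (P' : GL (Fin 2) F), e ≤ 1 ∧ valuation F β = valuation F (ϖ ^ e) ∧ valuation F g.det = 1 ∧
      g.det * σ β = -β ∧ β * σ g.trace + σ β * g.trace = 0 ∧
      ((P'⁻¹ * gGL * P' : GL (Fin 2) F) : Matrix (Fin 2) (Fin 2) F) = !![0, -g.det; 1, g.trace] ∧
      formCongr σ P' (!![0, 1; 1, 0] : Matrix (Fin 2) (Fin 2) F) = !![0, β; σ β, 0] := by
  have h0 := hϖ.ne_zero
  -- rescaling exponent: `|g₁₀| = |ϖ^m|`, `m = 2r + e`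
  obtain ⟨m, hm⟩ := exists_valuation_eq_valuation_zpow hϖ hg10
  obtain ⟨r, e, he, hme⟩ : ∃ (r : ℤ) (e : ℕ), e ≤ 1 ∧ m = 2 * r + e := ⟨m / 2, (m % 2).toNat, by omega, by omega⟩
  obtain ⟨a, ha⟩ : ∃ a : F, ϖ ^ (-r) = a := ⟨_, rfl⟩
  have ha0 : a ≠ 0 := by rw [← ha]; exact zpow_ne_zero _ h0
  have hσa : σ a = a := by rw [← ha, map_zpow₀, hσϖ]
  -- the rescaled isotropic cyclic frame (★ §1)
  obtain ⟨P', hC', hform', hdβ, htr⟩ := exists_rescaled_cyclicFrame σ gGL g hcoe hgU hg10 ha0 hσa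
  have hdv : valuation F g.det = 1 := by
    have h := congrArg (valuation F) hdβ
    rw [map_mul, Valuation.map_neg, hσv] at h
    exact mul_right_cancel₀ ((Valuation.ne_zero_iff _).2 hg10) (h.trans (one_mul _).symm)
  have hβ' : valuation F (a ^ 2 * g 1 0) = valuation F (ϖ ^ e) := by
    rw [map_mul, hm, ← map_mul, ← ha, ← zpow_natCast (ϖ ^ (-r)), ← _root_.zpow_mul, ← zpow_add₀ h0, ← zpow_natCast]
    congr 2; push_cast; omega
  have hdβ' : g.det * σ (a ^ 2 * g 1 0) = -(a ^ 2 * g 1 0) := by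
    rw [map_mul, map_pow, hσa]
    linear_combination a ^ 2 * hdβ
  have htr' : a ^ 2 * g 1 0 * σ g.trace + σ (a ^ 2 * g 1 0) * g.trace = 0 := by
    rw [map_mul, map_pow, hσa]
    linear_combination a ^ 2 * htr
  exact ⟨a ^ 2 * g 1 0, e, P', he, hβ', hdv, hdβ', htr', hC', hform'⟩

include hϖ hσϖ hσv in
/-- **THE AFFINE FRAME SOCKET, COUNTING FORM** (2-free): if moreover `(g − a·1)² = f·(g − a·1) + e′·1` (the Eisenstein relation of `g` at the centre `a`), then with
`β, e` as in `exists_antidiag_companion_frame_of_unitary_antidiagOne` and `γ′ := P′⁻¹ g P′` (`↑γ′ = C(tr g, det g)`): `(↑γ′ − a·1)² = f·(↑γ′ − a·1) + e′·1` and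
`#S(Φ₂, g) = #S(!![0, β; σβ, 0], γ′)` — the number of self-dual `g`-stable lattices for `Φ₂` equals that of self-dual `C`-stable lattices for `!![0, β; σβ, 0]`
(★ (L5-d1) FILE A `ncard_selfDualStable_congr`; for the plain socket take `a = 0`, `f = tr g`, `e′ = −det g`). [cite: Rogawski1990, §4.9 Lemma 4.9.3 p. 56] [cite: Flicker1998UnitaryFL, §6 p. 97] -/
theorem exists_antidiag_companion_affine_frame_ncard_eq_of_unitary_antidiagOne (gGL : GL (Fin 2) F) (g : Matrix (Fin 2) (Fin 2) F) (hcoe : (gGL : Matrix (Fin 2) (Fin 2) F) = g)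
    (hgU : (g.map σ)ᵀ * (!![0, 1; 1, 0] : Matrix (Fin 2) (Fin 2) F) * g = !![0, 1; 1, 0]) (hg10 : g 1 0 ≠ 0) {a f e' : F}
    (hk : (g - a • (1 : Matrix (Fin 2) (Fin 2) F)) * (g - a • (1 : Matrix (Fin 2) (Fin 2) F)) = f • (g - a • (1 : Matrix (Fin 2) (Fin 2) F)) + e' • (1 : Matrix (Fin 2) (Fin 2) F)) :
    ∃ (β : F) (e : ℕ) (γ' : GL (Fin 2) F), e ≤ 1 ∧ valuation F β = valuation F (ϖ ^ e) ∧ valuation F g.det = 1 ∧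
      g.det * σ β = -β ∧ β * σ g.trace + σ β * g.trace = 0 ∧
      ((γ' : GL (Fin 2) F) : Matrix (Fin 2) (Fin 2) F) = !![0, -g.det; 1, g.trace] ∧
      (((γ' : GL (Fin 2) F) : Matrix (Fin 2) (Fin 2) F) - a • (1 : Matrix (Fin 2) (Fin 2) F)) * (((γ' : GL (Fin 2) F) : Matrix (Fin 2) (Fin 2) F) - a • (1 : Matrix (Fin 2) (Fin 2) F)) =
        f • (((γ' : GL (Fin 2) F) : Matrix (Fin 2) (Fin 2) F) - a • (1 : Matrix (Fin 2) (Fin 2) F)) + e' • (1 : Matrix (Fin 2) (Fin 2) F) ∧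
      {Λ : Submodule 𝒪[F] (Fin 2 → F) |
          (∃ g₁ : GL (Fin 2) F, (∃ J' ∈ glInt 2 F, (J' : Matrix (Fin 2) (Fin 2) F) = formCongr σ g₁ (!![0, 1; 1, 0] : Matrix (Fin 2) (Fin 2) F)) ∧
            Λ = Submodule.span 𝒪[F] (Set.range ((g₁ : Matrix (Fin 2) (Fin 2) F))ᵀ)) ∧
          Λ.map ((Matrix.toLin' ((gGL : GL (Fin 2) F) : Matrix (Fin 2) (Fin 2) F)).restrictScalars 𝒪[F]) = Λ}.ncard =
      {Λ : Submodule 𝒪[F] (Fin 2 → F) |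
          (∃ g₁ : GL (Fin 2) F, (∃ J' ∈ glInt 2 F, (J' : Matrix (Fin 2) (Fin 2) F) = formCongr σ g₁ (!![0, β; σ β, 0] : Matrix (Fin 2) (Fin 2) F)) ∧
            Λ = Submodule.span 𝒪[F] (Set.range ((g₁ : Matrix (Fin 2) (Fin 2) F))ᵀ)) ∧
          Λ.map ((Matrix.toLin' ((γ' : GL (Fin 2) F) : Matrix (Fin 2) (Fin 2) F)).restrictScalars 𝒪[F]) = Λ}.ncard := by
  obtain ⟨β, e, P', he, hβ, hdv, hdβ, htr, hC, hform⟩ :=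
    exists_antidiag_companion_frame_of_unitary_antidiagOne hϖ σ hσϖ hσv gGL g hcoe hgU hg10
  refine ⟨β, e, P'⁻¹ * gGL * P', he, hβ, hdv, hdβ, htr, hC, ?_, ?_⟩
  · rw [Units.val_mul, Units.val_mul, hcoe]
    exact units_inv_mul_mul_affine_of_affine P' g hk
  · rw [ncard_selfDualStable_congr σ (!![0, 1; 1, 0] : Matrix (Fin 2) (Fin 2) F) gGL P', hform]

end Socket

/-! ## §3 The frame socket at an inert place `w ∣ v` -/

section AtPlace

variable (L : Type) [Field L] [NumberField L] [IsCMField L] (v : HeightOneSpectrum (𝓞 ↥(maximalRealSubfield L)))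
  (w : PlacesOver L v) (hw : IsCMField.complexConj L • w.1 = w.1)

omit [IsCMField L] in
/-- `(Φ₂)_w = !![0, 1; 1, 0]` (entries `0, 1` under `algebraMap`). [folklore] -/
private theorem placeForm_antidiagTwo_eq'' :
    placeForm (Matrix.of fun i j : Fin 2 => if i.val + j.val + 1 = 2 then (1 : L) else 0) w.1 = (!![0, 1; 1, 0] : Matrix (Fin 2) (Fin 2) (w.1.adicCompletion L)) := by
  ext i j
  fin_cases i <;> fin_cases j <;> simp [placeForm, Matrix.map_apply]

include hw in
/-- **THE AFFINE FRAME SOCKET AT THE PLACE `w`** (2-free; ★ `ncard_selfDualStable_antidiagTwo_eq_sum_of_unitary` with the binders `(h2v) (ht) (hirr) (N) (hN)` replaced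
by `g₁₀ ≠ 0` and the Eisenstein relation `(g − a·1)² = f·(g − a·1) + e′·1`, and the count left abstract): there are `β ∈ L_w`, `e ≤ 1`, `γ′ ∈ GL₂(L_w)` with
`|β| = |ϖ_w^e|`, `|det g| = 1`, `det g · σ_w β = −β`, `β σ_w(tr g) + σ_w β · tr g = 0`, `↑γ′ = !![0, −det g; 1, tr g]`, `(↑γ′ − a·1)² = f·(↑γ′ − a·1) + e′·1` and
`#S((Φ₂)_w, g) = #S(!![0, β; σ_w β, 0], γ′)`.  At `v ∤ 2` (`a = 0`) composing with ★ `ncard_selfDualStable_antidiag_companion_eq_sum_at` returns ★ §3; at `v ∣ 2` compose with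
the Eisenstein-centred count. [cite: Flicker1998UnitaryFL, §6 p. 97] [cite: Rogawski1990, §3.6 p. 31] -/
theorem exists_antidiag_companion_affine_frame_ncard_eq_of_unitary (hunr : Algebra.IsUnramifiedIn (𝓞 L) v.asIdeal)
    (gGL : GL (Fin 2) (w.1.adicCompletion L)) (g : Matrix (Fin 2) (Fin 2) (w.1.adicCompletion L)) (hcoe : (gGL : Matrix (Fin 2) (Fin 2) (w.1.adicCompletion L)) = g)
    (hgU : (g.map (galAdicCompletionMap (L := L) (IsCMField.complexConj L) hw))ᵀ * (!![0, 1; 1, 0] : Matrix (Fin 2) (Fin 2) (w.1.adicCompletion L)) * g = !![0, 1; 1, 0])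
    (hg10 : g 1 0 ≠ 0) {a f e' : (w.1.adicCompletion L)}
    (hk : (g - a • (1 : Matrix (Fin 2) (Fin 2) (w.1.adicCompletion L))) * (g - a • (1 : Matrix (Fin 2) (Fin 2) (w.1.adicCompletion L))) =
      f • (g - a • (1 : Matrix (Fin 2) (Fin 2) (w.1.adicCompletion L))) + e' • (1 : Matrix (Fin 2) (Fin 2) (w.1.adicCompletion L))) :
    ∃ (β : (w.1.adicCompletion L)) (e : ℕ) (γ' : GL (Fin 2) (w.1.adicCompletion L)), e ≤ 1 ∧
      valuation (w.1.adicCompletion L) β = valuation (w.1.adicCompletion L) ((toPlace v w (GaloisRepresentations.HeckeCharacter.uniformizer ↥(maximalRealSubfield L) v : v.adicCompletion ↥(maximalRealSubfield L))) ^ e) ∧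
      valuation (w.1.adicCompletion L) g.det = 1 ∧
      g.det * (galAdicCompletionMap (L := L) (IsCMField.complexConj L) hw) β = -β ∧
      β * (galAdicCompletionMap (L := L) (IsCMField.complexConj L) hw) g.trace + (galAdicCompletionMap (L := L) (IsCMField.complexConj L) hw) β * g.trace = 0 ∧
      ((γ' : GL (Fin 2) (w.1.adicCompletion L)) : Matrix (Fin 2) (Fin 2) (w.1.adicCompletion L)) = !![0, -g.det; 1, g.trace] ∧
      (((γ' : GL (Fin 2) (w.1.adicCompletion L)) : Matrix (Fin 2) (Fin 2) (w.1.adicCompletion L)) - a • (1 : Matrix (Fin 2) (Fin 2) (w.1.adicCompletion L))) *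
          (((γ' : GL (Fin 2) (w.1.adicCompletion L)) : Matrix (Fin 2) (Fin 2) (w.1.adicCompletion L)) - a • (1 : Matrix (Fin 2) (Fin 2) (w.1.adicCompletion L))) =
        f • (((γ' : GL (Fin 2) (w.1.adicCompletion L)) : Matrix (Fin 2) (Fin 2) (w.1.adicCompletion L)) - a • (1 : Matrix (Fin 2) (Fin 2) (w.1.adicCompletion L))) +
          e' • (1 : Matrix (Fin 2) (Fin 2) (w.1.adicCompletion L)) ∧
      {Λ : Submodule 𝒪[(w.1.adicCompletion L)] (Fin 2 → (w.1.adicCompletion L)) |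
          (∃ g' : GL (Fin 2) (w.1.adicCompletion L), (∃ J' ∈ glInt 2 (w.1.adicCompletion L), (J' : Matrix (Fin 2) (Fin 2) (w.1.adicCompletion L)) =
              formCongr (galAdicCompletionMap (L := L) (IsCMField.complexConj L) hw) g' (placeForm (Matrix.of fun i j : Fin 2 => if i.val + j.val + 1 = 2 then (1 : L) else 0) w.1)) ∧
            Λ = Submodule.span 𝒪[(w.1.adicCompletion L)] (Set.range ((g' : Matrix (Fin 2) (Fin 2) (w.1.adicCompletion L)))ᵀ)) ∧
          Λ.map ((Matrix.toLin' ((gGL : GL (Fin 2) (w.1.adicCompletion L)) : Matrix (Fin 2) (Fin 2) (w.1.adicCompletion L))).restrictScalars 𝒪[(w.1.adicCompletion L)]) = Λ}.ncard =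
      {Λ : Submodule 𝒪[(w.1.adicCompletion L)] (Fin 2 → (w.1.adicCompletion L)) |
          (∃ g' : GL (Fin 2) (w.1.adicCompletion L), (∃ J' ∈ glInt 2 (w.1.adicCompletion L), (J' : Matrix (Fin 2) (Fin 2) (w.1.adicCompletion L)) =
              formCongr (galAdicCompletionMap (L := L) (IsCMField.complexConj L) hw) g' (!![0, β; (galAdicCompletionMap (L := L) (IsCMField.complexConj L) hw) β, 0] : Matrix (Fin 2) (Fin 2) (w.1.adicCompletion L))) ∧
            Λ = Submodule.span 𝒪[(w.1.adicCompletion L)] (Set.range ((g' : Matrix (Fin 2) (Fin 2) (w.1.adicCompletion L)))ᵀ)) ∧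
          Λ.map ((Matrix.toLin' ((γ' : GL (Fin 2) (w.1.adicCompletion L)) : Matrix (Fin 2) (Fin 2) (w.1.adicCompletion L))).restrictScalars 𝒪[(w.1.adicCompletion L)]) = Λ}.ncard := by
  have hϖv := Liu2021.LemD1IndexedNonVacuityInertCofinite.valued_toPlace_uniformizer_of_isUnramifiedIn L v hunr w
  have hϖ : IsUniformizingElement (toPlace v w (GaloisRepresentations.HeckeCharacter.uniformizer ↥(maximalRealSubfield L) v : v.adicCompletion ↥(maximalRealSubfield L))) :=
    isUniformizingElement_of_v_eq hϖv
  haveI : IsDiscreteValuationRing 𝒪[(w.1.adicCompletion L)] := isDiscreteValuationRing_integer_of_compatible hϖv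
  have hσv : ∀ x, valuation (w.1.adicCompletion L) ((galAdicCompletionMap (L := L) (IsCMField.complexConj L) hw) x) = valuation (w.1.adicCompletion L) x := fun x =>
    valuation_galAdicCompletionMap_eq (IsCMField.complexConj L) v w hw x
  have hσϖ : (galAdicCompletionMap (L := L) (IsCMField.complexConj L) hw) (toPlace v w (GaloisRepresentations.HeckeCharacter.uniformizer ↥(maximalRealSubfield L) v : v.adicCompletion ↥(maximalRealSubfield L))) =
      (toPlace v w (GaloisRepresentations.HeckeCharacter.uniformizer ↥(maximalRealSubfield L) v : v.adicCompletion ↥(maximalRealSubfield L))) :=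
    galAdicCompletionMap_toPlace (IsCMField.complexConj L) w w hw _
  rw [placeForm_antidiagTwo_eq'' L v w]
  exact exists_antidiag_companion_affine_frame_ncard_eq_of_unitary_antidiagOne hϖ (galAdicCompletionMap (L := L) (IsCMField.complexConj L) hw) hσϖ hσv gGL g hcoe hgU hg10 hk

end AtPlace

end Literature.NumberTheory.Automorphic.UnitaryGroup
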